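import Summits.NavierStokesRegularity.NavierStokesRegularity.Theorems.SymmetryModuliCountTypeIAncientLiouvilleSmallRate
import Summits.NavierStokesRegularity.NavierStokesRegularity.Theorems.DssFarFieldSlavingBlowupTypeIDssProfileLambCurlMaximumPrinciple
import HarnessLib

/-!
# Route SymmetryModuliCount — the target `TypeIAncientLiouville` (stmt-NavierStokesRegularity-4050,
  (L') in the KNSS gauge) on the cell of SMALL LAMB-CURL DEFECT, at ANY rate `C`

Companion of `SymmetryModuliCountTypeIAncientLiouvilleSmallRate.lean` ((L') for `C < 1`, and on the
generalised-Beltrami cell `curl (ω × u) ≡ 0`). The cell pub-ns-dss's Lamb-curl defect floor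
(`LambCurlBound.typeI_ancient_eq_zero_of_curl_lamb_le`, file
`…TypeIDssProfileLambCurlMaximumPrinciple.lean`: weak maximum principle on the vorticity equation in Lamb
form, no spatial hypothesis) gives (L') at ANY `C` on the larger sub-class
`(−t)‖curl (ω × u)(t,x)‖ ≤ θ‖ω(t,x)‖` for all `t < 0`, `x`, for every `θ < 1` (the Beltrami cell is
`θ = 0`), in the route's INLINE vocabulary (bridged by `isTypeIAncientMild_iff`). Nothing is claimed off
this cell at `C ≥ 1` — that is the hard core (KNSS Conjecture (L) restricted to the Type-I class).

HONEST FRAMING: an exclusion statement about HYPOTHETICAL Type-I ancient mild fields under a pointwise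
hypothesis nobody asserts; nothing here bears on Navier–Stokes regularity. Lands
`--supports stmt-NavierStokesRegularity-4050`.
-/

noncomputable section

namespace Summit.NavierStokesRegularity.NavierStokesRegularity.Theorems

set_option linter.dupNamespace false

open MeasureTheory Set Function
open Literature.Analysis Literature.Analysis.FluidPDE
open Summit.NavierStokesRegularity.NavierStokesRegularity.Theorems.LambCurlBound

/-- **(L') on the cell of small Lamb-curl defect, ANY `C`**: every element of the route's class `A_C`
(smooth on `t < 0`, divergence free, KNSS-mild between all pairs of negative times, `|u| ≤ C/√(−t)`)
with `(−t)‖curl (curl u(t) × u(t))(x)‖ ≤ θ‖curl u(t)(x)‖` for all `t < 0`, `x` and `θ < 1` vanishes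
identically on `t < 0` (the Lamb-curl defect floor of cell pub-ns-dss through `isTypeIAncientMild_iff`;
`θ = 0` is `symmetryModuliCount_typeIAncientLiouville_of_generalisedBeltrami`). [this file] -/
theorem symmetryModuliCount_typeIAncientLiouville_of_curlLambDefect {θ : ℝ} (hθ : θ < 1) :
    ∀ (C : ℝ) (u : ℝ → EuclideanSpace ℝ (Fin 3) → EuclideanSpace ℝ (Fin 3)),
      ContDiffOn ℝ (⊤ : ℕ∞) (Function.uncurry u) (Set.Iio 0 ×ˢ Set.univ) ∧
        (∀ t < 0, Literature.Analysis.FluidPDE.VectorCalculus.IsDivFree (u t)) ∧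
        (∀ s t : ℝ, s < t → t < 0 → ∀ x, u t x = Literature.Analysis.FluidPDE.heatFlow (u s) (t - s) x -
          ∫ τ in Set.Ioo s t, ∫ y, Literature.Analysis.FluidPDE.oseenKernel (t - τ) (x - y) (u τ y) (u τ y)) ∧
        Literature.Analysis.FluidPDE.HasTypeITimeDecay C u →
      (∀ t < 0, ∀ x,
        (-t) * ‖curl (fun y => cross (curl (u t) y) (u t y)) x‖ ≤ θ * ‖curl (u t) x‖) →
      ∀ t < 0, ∀ x, u t x = 0 := by
  intro C u hu hdef
  exact typeI_ancient_eq_zero_of_curl_lamb_le (isTypeIAncientMild_iff.2 hu) hθ hdef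

end Summit.NavierStokesRegularity.NavierStokesRegularity.Theorems

end
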